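import Mathlib.Analysis.Real.Pi.Bounds
import Literature.AlgebraicGeometry.Frobenioids.CircleOpensProofs5
import HarnessLib

/-!
# Frobenioids II, Lemma 3.2 (vi): conditions (c), (d) — instance forms and universal closures

Mochizuki, *The geometry of Frobenioids II: Poly-Frobenioids*, Kyushu J. Math. **62** (2008)
401–460, §3, Lemma 3.2 (vi) p. 26 [cite: MochizukiFrdII2008, Lem 3.2 (vi) p.26]: for nonempty
connected open `A ⊆ B ⊆ S¹` with `A ≠ B`, "(c) The complement `B \ A` is connected. (d) If `B = S¹`,
then `B \ A` is of cardinality `≤ 1`."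

PROOF-ONLY companion of `CircleOpens.lean` (typer abc-iut-L1-t4): `CircleOpens.CondC`,
`CircleOpens.CondD` are the CONDITIONS (c), (d) NAMED inside Lemma 3.2 (vi) — parametrised predicates
(vocabulary), not facts; the printed CLAIM of (vi) is `CircleOpens.ItemVI`, PROVED as
`CircleOpens.ItemVI_holds` (`CircleOpensProofs5.lean`). This file records, for the cell's fact index
(rows F-0986 `CondC`, F-0987 `CondD`; seat abc-iut-f-029):
* the INSTANCE FORMS that do hold — `condC_univ` (for `B = S¹` condition (c) always holds: the
  complement of an open arc is a closed arc), `condD_of_ne_univ` ((d) is vacuous for `B ≠ S¹`),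
  `condD_univ_iff`, and the arc form `condC_arc_iff` of `CircleOpensSubarcs.lean`;
* kernel REFUTATIONS of the universal closures, even under the standing hypotheses of Lemma 3.2
  (`Setting A B`, `A ≠ B`): `not_forall_condC` (witness `A = exp(i·(1, 2)) ⊊ B = exp(i·(0, 3))`:
  `B \ A` is two arcs) and `not_forall_condD` (witness `A = exp(i·(1, 2)) ⊊ S¹`: `S¹ \ A` is a
  non-degenerate closed arc) — i.e. (c), (d) are genuine conditions, which is the content of (vi).
Nothing of [FrdII] is restated; no new definitions; nothing here is specific to the abc programme.
-/

namespace Literature.AlgebraicGeometry.Frobenioids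

open Set Function Topology Real
open scoped Pointwise

noncomputable section

namespace CircleOpens

/-! ### Instance forms -/

/-- **Condition (c) holds whenever `B = S¹`**: for a [nonempty] connected open `A ⊆ S¹`, `S¹ \ A` is
connected (empty if `A = S¹`, else the closed arc complementary to the open arc `A`; FrdII p. 26, used
in the proof of (vi)). [cite: MochizukiFrdII2008, Lem 3.2 (vi)(c) p.26] -/
theorem condC_univ {A : Set Circle} (hA : IsConnected A) (hAo : IsOpen A) : CondC A univ := by
  unfold CondC
  by_cases hne : A = univ
  · subst hne
    rw [sdiff_self]
    exact isPreconnected_empty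
  · obtain ⟨a, b, hab, hlen, rfl⟩ := exists_eq_exp_image_Ioo hA hAo hne
    rw [univ_diff_arc hab hlen]
    exact isPreconnected_Icc.image _ Circle.exp.continuous.continuousOn

/-- **Condition (d) is vacuous for `B ≠ S¹`.** [cite: MochizukiFrdII2008, Lem 3.2 (vi)(d) p.26] -/
theorem condD_of_ne_univ {A B : Set Circle} (hB : B ≠ univ) : CondD A B := fun h => absurd h hB

/-- **Condition (d) for `B = S¹`** is "`S¹ \ A` has at most one point".
[cite: MochizukiFrdII2008, Lem 3.2 (vi)(d) p.26] -/
theorem condD_univ_iff {A : Set Circle} : CondD A univ ↔ (univ \ A).Subsingleton :=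
  ⟨fun h => h rfl, fun h _ => h⟩

/-! ### The universal closures are false (conditions (c), (d) are genuine conditions) -/

/-- The witness pair: `A = exp(i·(1, 2)) ⊆ B = exp(i·(0, 3))` is a `Setting` with `A ≠ B`.
[cite: MochizukiFrdII2008, Lem 3.2 (vi) p.26] -/
theorem setting_arc_one_two_zero_three :
    Setting (Circle.exp '' Ioo 1 2) (Circle.exp '' Ioo 0 3) ∧
      Circle.exp '' Ioo 1 2 ≠ Circle.exp '' Ioo 0 3 := by
  refine ⟨⟨isConnected_exp_image_Ioo (by norm_num), isOpen_exp_image isOpen_Ioo,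
    isConnected_exp_image_Ioo (by norm_num), isOpen_exp_image isOpen_Ioo,
    image_mono (Ioo_subset_Ioo (by norm_num) (by norm_num))⟩, fun h => ?_⟩
  have := (exp_image_Ioo_eq_iff (c := 0) (by norm_num) (by norm_num) (by norm_num)
    (by linarith [pi_gt_three]) le_rfl (by linarith [pi_gt_three])).mp h
  exact absurd this.1 (by norm_num)

/-- **The universal closure of condition (c) is false, even under the standing hypotheses of
Lemma 3.2** (`A ⊆ B` nonempty connected open, `A ≠ B`): for `A = exp(i·(1, 2))`, `B = exp(i·(0, 3))`
the complement `B \ A = exp(i·((0, 1] ∪ [2, 3)))` is not connected (`condC_arc_iff`: inside a proper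
arc, (c) holds iff `A` and `B` share an endpoint). [cite: MochizukiFrdII2008, Lem 3.2 (vi)(c) p.26] -/
theorem not_forall_condC : ¬ ∀ A B : Set Circle, Setting A B → A ≠ B → CondC A B := by
  intro h
  obtain ⟨hS, hne⟩ := setting_arc_one_two_zero_three
  have := (condC_arc_iff (c := 0) (d := 3) (a := 1) (b := 2) (by linarith [pi_gt_three])
    (by norm_num) (by norm_num) (by norm_num)).mp (h _ _ hS hne)
  rcases this with h0 | h3
  · norm_num at h0
  · norm_num at h3

/-- In particular the bare universal closure of `CondC` is false.
[cite: MochizukiFrdII2008, Lem 3.2 (vi)(c) p.26] -/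
theorem not_forall_condC' : ¬ ∀ A B : Set Circle, CondC A B :=
  fun h => not_forall_condC fun A B _ _ => h A B

/-- **The universal closure of condition (d) is false, even under the standing hypotheses of
Lemma 3.2**: for `A = exp(i·(1, 2)) ⊊ S¹` the complement `S¹ \ A` is the closed arc
`exp(i·[2, 1 + 2π])`, which contains the two distinct points `exp(3i)`, `exp(4i)`.
[cite: MochizukiFrdII2008, Lem 3.2 (vi)(d) p.26] -/
theorem not_forall_condD : ¬ ∀ A B : Set Circle, Setting A B → A ≠ B → CondD A B := by
  intro h
  have hA : IsConnected (Circle.exp '' Ioo (1 : ℝ) 2) := isConnected_exp_image_Ioo (by norm_num)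
  have hAo : IsOpen (Circle.exp '' Ioo (1 : ℝ) 2) := isOpen_exp_image isOpen_Ioo
  have hinj := Circle.exp_injOn_Ico (a := 1) (b := 1 + 2 * π) (by linarith)
  -- `exp(3i)`, `exp(4i)` lie outside `A`
  have hnot : ∀ x : ℝ, 2 ≤ x → x < 1 + 2 * π → Circle.exp x ∉ Circle.exp '' Ioo (1 : ℝ) 2 := by
    rintro x hx hx' ⟨y, hy, hyx⟩
    have : y = x := hinj ⟨hy.1.le, by linarith [hy.2, pi_gt_three]⟩ ⟨by linarith, hx'⟩ hyx
    linarith [hy.2]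
  have h3 := hnot 3 (by norm_num) (by linarith [pi_gt_three])
  have h4 := hnot 4 (by norm_num) (by linarith [pi_gt_three])
  have hne : Circle.exp '' Ioo (1 : ℝ) 2 ≠ univ := fun e => h3 (e ▸ mem_univ _)
  have hsub : (univ \ Circle.exp '' Ioo (1 : ℝ) 2).Subsingleton :=
    h _ _ (setting_univ hA hAo) hne rfl
  have h34 : Circle.exp (3 : ℝ) = Circle.exp 4 := hsub ⟨mem_univ _, h3⟩ ⟨mem_univ _, h4⟩
  have := hinj ⟨by norm_num, by linarith [pi_gt_three]⟩ ⟨by norm_num, by linarith [pi_gt_three]⟩ h34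
  norm_num at this

/-- In particular the bare universal closure of `CondD` is false.
[cite: MochizukiFrdII2008, Lem 3.2 (vi)(d) p.26] -/
theorem not_forall_condD' : ¬ ∀ A B : Set Circle, CondD A B :=
  fun h => not_forall_condD fun A B _ _ => h A B

end CircleOpens

end

end Literature.AlgebraicGeometry.Frobenioids
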